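import Summits.QuantumAdvantage.AdviceFreeQNC0.HiddenCoinsReduction
import HarnessLib

/-!
# Route OddPrimeWalk, support item `HiddenCoinsFourOdd` (stmt-QuantumAdvantage-27289, rung J_4 "hidden coins"): four common
# hidden coordinates cap the win of α's u-walk game at `3/4`

The item `HiddenCoinsFourOdd` (planner qa-qnc0-p2 g20, ROUND-20 (p2) §2) — every strategy for `ringWinU c` all of whose cuts read
only a common set `J` of input bits with `|J| + 4 ≤ n` (arbitrary tables, any complexity, any positions) wins on at most `(3/4)·2ⁿ`
inputs — is `HiddenCoinsBound 4 (3/4)` unfolded, i.e. the tree theorem `Summit.QuantumAdvantage.AdviceFreeQNC0.hiddenCoinsFour`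
(`AdviceFreeQNC0/HiddenCoinsReduction.lean`: fibre reduction to the free-phase oblivious game `G_4` + `FreePhase.bound_four`,
kernel-evaluated with the standard axioms).  Removes the polylog junta-size restriction of `walkHardFJunta` (θ there `1 − η₀/4`).
WHAT THIS IS NOT: instrument for cruxes `ManyReadersSqrtOdd` (23109) / `DenseResidualSqrtOdd` (23029) via R11″, not a crux;
separation NOT moved.
-/

set_option linter.dupNamespace false

namespace Summit.QuantumAdvantage.QuantumAdvantage.Theorems

/-- **Item `HiddenCoinsFourOdd` (J_4) — PROVED** (signature verbatim; one line over `AdviceFreeQNC0.hiddenCoinsFour`). -/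
theorem oddPrimeWalk_hiddenCoinsFourOdd : ∀ n c : ℕ, ∀ J : Finset (Fin n), J.card + 4 ≤ n → ∀ y : Fin (n + 1) → (Fin n → Bool) → Bool, (∀ g, ∀ u v : Fin n → Bool, (∀ i ∈ J, u i = v i) → y g u = y g v) → ((Finset.univ.filter fun u : Fin n → Bool => Summit.QuantumAdvantage.AdviceFreeQNC0.ringWinU c y u = true).card : ℝ) ≤ (3 / 4 : ℝ) * (2 : ℝ) ^ n :=
  Summit.QuantumAdvantage.AdviceFreeQNC0.hiddenCoinsFour

end Summit.QuantumAdvantage.QuantumAdvantage.Theorems
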